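import Summits.CriticalPhenomena.CardyFormulaZ2.Theses.CardyIsoradial
import HarnessLib

/-!
# Birth skeleton for the crux `CardyIsoradial.IsoAnchor`
(item `stmt-CriticalPhenomena-0786`, route `route-CriticalPhenomena-CardyIsoradial`, sub-problem
`CardyFormulaZ2`; BC3 skeleton registered by the skeleton registrar, 2026-08-17)

The crux `IsoAnchor`: SOME member `(G, emb, ε)` of Grimmett–Manolescu's class `𝒢` (preconnected,
isoradial, rhombic tiling, square-grid property, `BAP(ε)`), under its canonical critical bond law
`emb.isoradialPercolation`, satisfies Cardy's formula for every conformal rectangle in the crude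
discretisation `embDomainCrossing` (limit `cardyFunction η`).

## The line: symmetry first, value second (Schramm's principle on the isoradial class)

Star–triangle transport — the route's technique class — moves crossing events between members of
`𝒢` but never computes a value (Grimmett2014ICM §5(A)).  The line therefore separates what
transport / RSW geometry can deliver on an anchor (existence of the limits, and their conformal
invariance in transport form, value unspecified) from the identification of the universal profile
with Cardy's `F`, which comes from a different mechanism (conformally invariant crossing limits of a
local percolation model drive the exploration path to SLE₆ — Schramm2000 §1.5, LSW2001 §3,
CamiaNewman2007, Smirnov2001 Thm 2 — and SLE₆ returns `F`).  Writing
`p_G R δ := emb.isoradialPercolation.real (embDomainCrossing emb.z R.carrier δ (R.arc 0) (R.arc 2))`: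

* `stub_anchorLimits` — **existence on an anchor**: some `(G, emb, ε) ∈ 𝒢` for which every
  conformal rectangle `R` has SOME limit `L_R` of `p_G R δ` as `δ → 0⁺` (no invariance, no value).
* `stub_confInvTransport` — **conformal invariance in transport form on `𝒢`**: for every member of
  `𝒢`, two conformal rectangles carrying uniformizing data of equal cross-ratio have the same
  limiting crossing probability whenever one of them has a limit (the isoradial analogue of the
  `ℤ²` item `CardyUniqueLimit.ConfInvTransport`, stmt-CriticalPhenomena-0794).
* `stub_cardyRigidity` — **identification of the profile on `𝒢`**: for every member of `𝒢`, if all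
  conformal rectangles have crossing limits `f η` for one profile `f : ℝ → ℝ`, then `f = F` on
  `(0,1)` (the isoradial analogue of `CardyUniqueLimit.CardyRigidity`, stmt-CriticalPhenomena-0746).

The composition `IsoAnchor_of` is genuine glue (choice + the proved Literature lemma
`ConformalRectangle.crossRatio_mem_Ioo_of_isUniformizing`): from the anchor's limits `L_R` define the
profile `f η :=` the limit of SOME rectangle admitting a uniformizing datum of cross-ratio `η`
(junk `0` if none), transport it to every rectangle of cross-ratio `η` by `stub_confInvTransport`,
identify `f = F` on `(0,1)` by `stub_cardyRigidity`, and conclude because every uniformizing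
cross-ratio lies in `(0,1)`.  Sorries: exactly the three `stub_*`; `IsoAnchor_of : Sig.stub_anchorLimits →
Sig.stub_confInvTransport → Sig.stub_cardyRigidity → IsoAnchor` is sorry-free and concludes the crux
BY NAME (the `Sig.stub_*` Props are the stub statements verbatim).

Disproof used: none on file for this crux (`ledger crux ls stmt-CriticalPhenomena-0786`: no
workfiles, no `Disproof.lean`, no `Negative/` lemmas, 2026-08-17).  Negatives index checked
(`ledger negatives --problem CriticalPhenomena`, 11 entries): the only rigidity-type negative,
`Theorems.not_SymmetryUpgrade` (stmt-CriticalPhenomena-0698), refutes the ABSTRACT upgrade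
"similarity-covariant + Markov + local + target-independent chordal family ⇒ SLE₆" by a surgery
family that is not a lattice limit; `stub_cardyRigidity` keeps the percolation measure of a member of
`𝒢` in its hypothesis (the repaired clause the refutation itself names), so it is not an instance.
-/

namespace Summit.CriticalPhenomena.CardyFormulaZ2.Cruxes.IsoAnchor.Birth

open scoped Topology
open Filter Set
open Literature.Probability.RandomPlanarGeometry (ConformalRectangle ConformalEquiv cardyFunction
  crossRatio)
open Literature.Probability.Percolation (embDomainCrossing)
open Literature.Probability.LatticeModels (RhombicEmbedding)
open Summit.CriticalPhenomena.CardyFormulaZ2.Theses.CardyIsoradial (IsoAnchor)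

/-! ### The stub SIGNATURES

Each stub's statement is ALSO recorded as the `Prop` `Sig.stub_<name>` (verbatim the statement of the
registered `theorem stub_<name>` below), so that the composition `IsoAnchor_of` takes the three
statements as hypotheses whose heads are the stub names (layer-invariant skeleton audit
`#h21_check_skeleton`). Obligation tags (`@[stub]`) are gate-stamped, not written here.
`p_G R δ` below abbreviates
`emb.isoradialPercolation.real (embDomainCrossing emb.z R.carrier δ (R.arc 0) (R.arc 2))`. -/

/-- Signature of STUB 1 (`stub_anchorLimits`): existence of crossing limits on an anchor of `𝒢`. -/
def Sig.stub_anchorLimits : Prop :=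
    ∃ (V F : Type) (_ : Countable V) (_ : DecidableEq V) (_ : DecidableEq F) (G : SimpleGraph V)
      (_ : G.LocallyFinite) (emb : Literature.Probability.LatticeModels.RhombicEmbedding G F) (ε : ℝ),
      G.Preconnected ∧ emb.IsIsoradial ∧ emb.IsRhombicTiling ∧ emb.HasSquareGridProperty ∧ 0 < ε ∧
      emb.HasBoundedAngles ε ∧
      ∀ R : Literature.Probability.RandomPlanarGeometry.ConformalRectangle, ∃ L : ℝ,
        Filter.Tendsto (fun δ ↦ emb.isoradialPercolation.real
          (Literature.Probability.Percolation.embDomainCrossing emb.z R.carrier δ (R.arc 0) (R.arc 2)))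
          (nhdsWithin 0 (Set.Ioi 0)) (nhds L)

/-- Signature of STUB 2 (`stub_confInvTransport`): conformal invariance of crossing limits in
transport form, on every member of `𝒢`. -/
def Sig.stub_confInvTransport : Prop :=
    ∀ (V F : Type) [Countable V] [DecidableEq V] [DecidableEq F] (G : SimpleGraph V) [G.LocallyFinite]
      (emb : Literature.Probability.LatticeModels.RhombicEmbedding G F), G.Preconnected → emb.IsIsoradial →
      emb.IsRhombicTiling → emb.HasSquareGridProperty → ∀ ε : ℝ, 0 < ε → emb.HasBoundedAngles ε →
      ∀ (R R' : Literature.Probability.RandomPlanarGeometry.ConformalRectangle)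
        (φ : Literature.Probability.RandomPlanarGeometry.ConformalEquiv UpperHalfPlane.upperHalfPlaneSet R.carrier)
        (x : Fin 4 → ℝ)
        (φ' : Literature.Probability.RandomPlanarGeometry.ConformalEquiv UpperHalfPlane.upperHalfPlaneSet R'.carrier)
        (x' : Fin 4 → ℝ), R.IsUniformizing φ x → R'.IsUniformizing φ' x' →
        Literature.Probability.RandomPlanarGeometry.crossRatio x =
          Literature.Probability.RandomPlanarGeometry.crossRatio x' →
        ∀ L : ℝ,
          Filter.Tendsto (fun δ ↦ emb.isoradialPercolation.real
            (Literature.Probability.Percolation.embDomainCrossing emb.z R.carrier δ (R.arc 0) (R.arc 2)))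
            (nhdsWithin 0 (Set.Ioi 0)) (nhds L) →
          Filter.Tendsto (fun δ ↦ emb.isoradialPercolation.real
            (Literature.Probability.Percolation.embDomainCrossing emb.z R'.carrier δ (R'.arc 0) (R'.arc 2)))
            (nhdsWithin 0 (Set.Ioi 0)) (nhds L)

/-- Signature of STUB 3 (`stub_cardyRigidity`): Cardy rigidity of a conformally invariant crossing
profile, on every member of `𝒢`. -/
def Sig.stub_cardyRigidity : Prop :=
    ∀ (V F : Type) [Countable V] [DecidableEq V] [DecidableEq F] (G : SimpleGraph V) [G.LocallyFinite]
      (emb : Literature.Probability.LatticeModels.RhombicEmbedding G F), G.Preconnected → emb.IsIsoradial →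
      emb.IsRhombicTiling → emb.HasSquareGridProperty → ∀ ε : ℝ, 0 < ε → emb.HasBoundedAngles ε →
      ∀ f : ℝ → ℝ,
        (∀ R : Literature.Probability.RandomPlanarGeometry.ConformalRectangle,
          R.HasCrossingLimit (fun δ ↦ emb.isoradialPercolation.real
            (Literature.Probability.Percolation.embDomainCrossing emb.z R.carrier δ (R.arc 0) (R.arc 2))) f) →
        Set.EqOn f Literature.Probability.RandomPlanarGeometry.cardyFunction (Set.Ioo 0 1)

/-! ### The registered stubs (the ONLY sorries of this file) -/

/-- **STUB 1 — EXISTENCE OF CROSSING LIMITS ON AN ANCHOR.** Some member `(G, emb, ε)` of `𝒢`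
(preconnected, isoradial, rhombic tiling, square-grid property, `BAP(ε)`) for which, for every
conformal rectangle `R`, the crude crossing probabilities `p_G R δ` of its canonical critical bond law
converge to some `L_R` as `δ → 0⁺` — no conformal invariance and no value claimed.  The weakest shadow
of the universality conjecture (Grimmett2014ICM §5(B); Literature `CardyUniversality`, open); RSW holds
uniformly on `𝒢` (GrimmettManolescu2014 Thm 1.1, tree `gm_boxCrossing`), so all cluster points lie in
`(0,1)` (ℤ² version proved: `discreteCrossingProb_clusterPt_mem_Ioo_holds`); the `∃` lets the prover
choose the member (self-dual ℤ² ∈ 𝒢, `SquareLatticeInClass`; bond-𝕋 ∈ 𝒢, `triIsoradialInstance_proof`).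
Why it might fail: no monotonicity / sub-multiplicativity in `δ` is known; `p(δ)` may oscillate between
two cluster points (Grimmett1999 §11.10; BollobasRiordan2006 Ch. 7 Conj. 1).  ℤ² analogue: route item
`CardyUniqueLimit.LimitExists` (stmt-CriticalPhenomena-0747). -/
theorem stub_anchorLimits :
    ∃ (V F : Type) (_ : Countable V) (_ : DecidableEq V) (_ : DecidableEq F) (G : SimpleGraph V)
      (_ : G.LocallyFinite) (emb : Literature.Probability.LatticeModels.RhombicEmbedding G F) (ε : ℝ),
      G.Preconnected ∧ emb.IsIsoradial ∧ emb.IsRhombicTiling ∧ emb.HasSquareGridProperty ∧ 0 < ε ∧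
      emb.HasBoundedAngles ε ∧
      ∀ R : Literature.Probability.RandomPlanarGeometry.ConformalRectangle, ∃ L : ℝ,
        Filter.Tendsto (fun δ ↦ emb.isoradialPercolation.real
          (Literature.Probability.Percolation.embDomainCrossing emb.z R.carrier δ (R.arc 0) (R.arc 2)))
          (nhdsWithin 0 (Set.Ioi 0)) (nhds L) := by
  sorry

/-- **STUB 2 — CONFORMAL INVARIANCE IN TRANSPORT FORM ON `𝒢`.** For every member of `𝒢` and any
two conformal rectangles `R`, `R'` carrying uniformizing data of equal cross-ratio, a limit `L` of
`p_G R δ` is also the limit of `p_G R' δ`.  Scalings are exact symmetries of `embDomainCrossing`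
(`p(λR, δ) = p(R, δ/λ)`); rotations are DKKMO's theorem for the rectangular isoradial embeddings of ℤ²
at `q = 1` (DKKMO2020Rotational = arXiv:2012.11672 Thm 1.2 / Cor 1.3; tree `dkkmo_rotation_invariance`,
`dkkmo_universality_coupling`), produced inside `𝒢` by star–triangle track exchanges — the route's own
mechanism; the upgrade similarity → conformal is the open heart (Schramm2007ICM Problem 2.11).  Why it
might fail: it IS value-free conformal invariance for every member, including the aperiodic Penrose
members of `𝒢` (GM2014 §4.3.3) where not even rotation invariance is in print;
`Literature.Barriers.CriticalPhenomena.EmbeddingModulusUniqueness` (Beffara2008 Prop. 4) forbids any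
embedding-blind proof — evaded because the statement is posed on the isoradial embedding `emb.z`.
ℤ² analogue: route item `CardyUniqueLimit.ConfInvTransport` (stmt-CriticalPhenomena-0794). -/
theorem stub_confInvTransport :
    ∀ (V F : Type) [Countable V] [DecidableEq V] [DecidableEq F] (G : SimpleGraph V) [G.LocallyFinite]
      (emb : Literature.Probability.LatticeModels.RhombicEmbedding G F), G.Preconnected → emb.IsIsoradial →
      emb.IsRhombicTiling → emb.HasSquareGridProperty → ∀ ε : ℝ, 0 < ε → emb.HasBoundedAngles ε →
      ∀ (R R' : Literature.Probability.RandomPlanarGeometry.ConformalRectangle)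
        (φ : Literature.Probability.RandomPlanarGeometry.ConformalEquiv UpperHalfPlane.upperHalfPlaneSet R.carrier)
        (x : Fin 4 → ℝ)
        (φ' : Literature.Probability.RandomPlanarGeometry.ConformalEquiv UpperHalfPlane.upperHalfPlaneSet R'.carrier)
        (x' : Fin 4 → ℝ), R.IsUniformizing φ x → R'.IsUniformizing φ' x' →
        Literature.Probability.RandomPlanarGeometry.crossRatio x =
          Literature.Probability.RandomPlanarGeometry.crossRatio x' →
        ∀ L : ℝ,
          Filter.Tendsto (fun δ ↦ emb.isoradialPercolation.real
            (Literature.Probability.Percolation.embDomainCrossing emb.z R.carrier δ (R.arc 0) (R.arc 2)))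
            (nhdsWithin 0 (Set.Ioi 0)) (nhds L) →
          Filter.Tendsto (fun δ ↦ emb.isoradialPercolation.real
            (Literature.Probability.Percolation.embDomainCrossing emb.z R'.carrier δ (R'.arc 0) (R'.arc 2)))
            (nhdsWithin 0 (Set.Ioi 0)) (nhds L) := by
  sorry

/-- **STUB 3 — CARDY RIGIDITY ON `𝒢` (load-bearing).** For every member of `𝒢`: if the crude
crossing probabilities of ALL conformal rectangles converge to one profile `f` of the cross-ratio,
then `f = cardyFunction` on `(0,1)`.  Mechanism (Schramm's principle): with `f` as hitting kernel,
RSW on `𝒢` (`gm_boxCrossing`) + Aizenman–Burchard tightness give subsequential limits of the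
primal/dual exploration interface (planar for every rhombic tiling) that are conformally invariant
domain-Markov curves, hence SLE_κ (Schramm2000 = arXiv:math/9904022 §1.5); percolation locality forces
`κ = 6` (LawlerSchrammWerner2001 = arXiv:math/9911084 §3; tree fact
`eq_six_of_forall_measureReal_hitsBefore`) and SLE₆ returns `f = F` (tree, proved:
`sle_six_measureReal_hitsBefore_holds`); CamiaNewman2007 Thm 2–3 / Smirnov2001 Thm 2 are the 𝕋
template.  Vacuous for members without limits, provable unconditionally.  Why it might fail:
Camia–Newman's convergence needs the kernel in admissible non-Jordan domains along moving meshes, more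
than fixed Jordan rectangles give (CN2007 p. 489); exploration interfaces on general isoradial graphs
are not itemised in Literature.  Not an instance of the refuted abstract upgrade
`Theorems.not_SymmetryUpgrade` (stmt-CriticalPhenomena-0698): the hypothesis keeps the lattice
measure.  ℤ² analogue: route item `CardyUniqueLimit.CardyRigidity` (stmt-CriticalPhenomena-0746). -/
theorem stub_cardyRigidity :
    ∀ (V F : Type) [Countable V] [DecidableEq V] [DecidableEq F] (G : SimpleGraph V) [G.LocallyFinite]
      (emb : Literature.Probability.LatticeModels.RhombicEmbedding G F), G.Preconnected → emb.IsIsoradial →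
      emb.IsRhombicTiling → emb.HasSquareGridProperty → ∀ ε : ℝ, 0 < ε → emb.HasBoundedAngles ε →
      ∀ f : ℝ → ℝ,
        (∀ R : Literature.Probability.RandomPlanarGeometry.ConformalRectangle,
          R.HasCrossingLimit (fun δ ↦ emb.isoradialPercolation.real
            (Literature.Probability.Percolation.embDomainCrossing emb.z R.carrier δ (R.arc 0) (R.arc 2))) f) →
        Set.EqOn f Literature.Probability.RandomPlanarGeometry.cardyFunction (Set.Ioo 0 1) := by
  sorry

/-! ### The composition (sorry-free): the three stubs give the crux BY NAME -/

/-- **`IsoAnchor` from the three stubs.**  From the anchor of stub 1 and its limits `L_R`, build by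
choice a profile `f` (value at `η` = the limit of some rectangle with a uniformizing datum of
cross-ratio `η`, junk `0` if none), show `R.HasCrossingLimit (p_G R) f` for every `R` by the transport
stub 2, identify `f = F` on `(0,1)` by the rigidity stub 3, and conclude with the proved Literature
lemma `ConformalRectangle.crossRatio_mem_Ioo_of_isUniformizing`. -/
theorem IsoAnchor_of :
    Sig.stub_anchorLimits → Sig.stub_confInvTransport → Sig.stub_cardyRigidity →
      Summit.CriticalPhenomena.CardyFormulaZ2.Theses.CardyIsoradial.IsoAnchor := by
  intro hA hT hR
  dsimp only [Sig.stub_anchorLimits] at hA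
  dsimp only [Sig.stub_confInvTransport] at hT
  dsimp only [Sig.stub_cardyRigidity] at hR
  classical
  obtain ⟨V, F, iC, iDV, iDF, G, iLF, emb, ε, hpre, hiso, htile, hsgp, hε, hbap, hlim⟩ := hA
  -- the anchor's limits, one per conformal rectangle
  choose L hL using hlim
  -- a profile `f` of the cross-ratio, by choice, with `R.HasCrossingLimit (p_G R) f` for every `R`
  obtain ⟨f, hf⟩ : ∃ f : ℝ → ℝ, ∀ R : ConformalRectangle,
      R.HasCrossingLimit (fun δ ↦ emb.isoradialPercolation.real
        (embDomainCrossing emb.z R.carrier δ (R.arc 0) (R.arc 2))) f := by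
    refine ⟨fun η ↦ if h : ∃ (R'' : ConformalRectangle)
        (φ'' : ConformalEquiv UpperHalfPlane.upperHalfPlaneSet R''.carrier) (x'' : Fin 4 → ℝ),
        R''.IsUniformizing φ'' x'' ∧ crossRatio x'' = η then L h.choose else 0, ?_⟩
    intro R φ x hux
    have hex : ∃ (R'' : ConformalRectangle)
        (φ'' : ConformalEquiv UpperHalfPlane.upperHalfPlaneSet R''.carrier) (x'' : Fin 4 → ℝ),
        R''.IsUniformizing φ'' x'' ∧ crossRatio x'' = crossRatio x := ⟨R, φ, x, hux, rfl⟩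
    obtain ⟨φ'', x'', hux'', hcr⟩ := hex.choose_spec
    simp only [dif_pos hex]
    exact hT V F G emb hpre hiso htile hsgp ε hε hbap hex.choose R φ'' x'' φ x hux'' hux hcr
      (L hex.choose) (hL hex.choose)
  -- identification of the profile on (0,1)
  have hEq : Set.EqOn f cardyFunction (Set.Ioo 0 1) :=
    hR V F G emb hpre hiso htile hsgp ε hε hbap f hf
  refine ⟨V, F, iC, iDV, iDF, G, iLF, emb, ε, hpre, hiso, htile, hsgp, hε, hbap, ?_⟩
  intro R φ x hux
  have hη : crossRatio x ∈ Set.Ioo (0 : ℝ) 1 :=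
    ConformalRectangle.crossRatio_mem_Ioo_of_isUniformizing hux
  rw [← hEq hη]
  exact hf R φ x hux

/-- **… with the registered stubs plugged in** (no new sorry: an `example` is not a declaration): the
skeleton proves the crux by name modulo exactly the three `sorry`s of `stub_anchorLimits`,
`stub_confInvTransport`, `stub_cardyRigidity`, whose statements are literally the `Sig.*` hypotheses. -/
example : Summit.CriticalPhenomena.CardyFormulaZ2.Theses.CardyIsoradial.IsoAnchor :=
  IsoAnchor_of stub_anchorLimits stub_confInvTransport stub_cardyRigidity

end Summit.CriticalPhenomena.CardyFormulaZ2.Cruxes.IsoAnchor.Birth
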